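import Mathlib.Analysis.Calculus.ContDiff.Basic
import Mathlib.Analysis.SpecialFunctions.SmoothTransition
import Literature.Analysis.FunctionSpaces.Complexify
import Literature.Analysis.FunctionSpaces.FlatTorus
import Literature.Analysis.FunctionSpaces.TorusCalculus
import Literature.Analysis.FunctionSpaces.TorusTestFunction
import Literature.Analysis.FunctionSpaces.TorusSobolevNorm
import Literature.Analysis.FunctionSpaces.TorusSobolevNormProofs
import Literature.Analysis.FunctionSpaces.TorusFluidGlue
import HarnessLib

-- provenance: harness21/H21/H21/Statements/NS/BuckmasterVicol.lean @ dbe5a04 (interim HEAD d8f2665); M5 mechanical rewrite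
/-!
# Buckmaster–Vicol nonuniqueness of weak solutions of Navier–Stokes on `T³`
(family: NS, statement ns.S18; trunk Sobolev, outline `H21/Outlines/Sobolev.md`, item
`NSBuckmasterVicol`; namespace `Literature.NS`, coexisting with the accepted `Statements/NS/Wave0.lean`)

Buckmaster–Vicol (Ann. of Math. 189 (2019), Thm. 1.2): *there exists `β > 0` such that for any
nonnegative smooth function `e : [0,T] → ℝ≥0` there is a weak solution
`v ∈ C⁰_t([0,T]; H^β_x(T³))` of the (unforced) Navier–Stokes equations with
`∫_{T³} |v(x,t)|² dx = e(t)` for all `t ∈ [0,T]`.* In particular (op. cit., the paragraph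
following Thm. 1.2, p. 4: "`v ≡ 0` is not the only weak solution which vanishes at a time slice,
thereby implying the nonuniqueness of weak solutions"; Thm. 1.3 there is the vanishing-viscosity
result) weak solutions in this class are not unique: `v ≡ 0` and a solution with a positive
energy profile vanishing on an initial time interval share the zero initial datum
(`buckmasterVicol_nonunique_weak_solutions`, PROVED below from the Thm. 1.2 fact).

## Design

* The torus is `UnitAddTorus (Fin 3)` (`FlatTorus`), fields are `v : ℝ → T³ → EuclideanSpace ℝ
  (Fin 3)` (time first), weak solutions are `Torus.IsWeakNSSolutionOn T ν v`
  (`TorusFluidGlue`, BV Def. 1.1 without the mean-zero normalisation). BV Def. 1.1 requires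
  `∫ v(t) = 0`; the shared predicate omits it by design (outline §C12), so the conclusion of
  `NS.buckmasterVicol_nonuniqueness` adds the conjunct `∀ t, Torus.HasZeroMean (v t)`, restoring
  Def. 1.1 exactly.
* `C⁰_t H^β_x` is `Torus.ContinuousInSobolevOn (Icc 0 T) β (fun t ↦ complexify ∘ v t)`
  (`TorusSobolevNorm`, spectral `H^β` of the complexified field, `Complexify`).
* BV fix a kinematic viscosity `ν ∈ (0,1]` (op. cit. p. 3: "The constant `ν ∈ (0,1]` is the
  kinematic viscosity") and Thm. 1.2 produces `β > 0` for that `ν`; the printed form is vendored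
  as `Literature.Barriers.NavierStokesRegularity.BuckmasterVicol2019_thm12`
  (`Literature/Barriers/NavierStokesRegularity/BuckmasterVicolNonuniquenessProofs.lean`). We state
  the `ν`-general form with one `β` for all `ν > 0`, as mandated by the outline; this is not a
  strengthening in substance: it follows from the printed statement at `ν = 1` by the time
  rescaling `u(t,x) = ν v(νt,x)` on the unit torus, PROVED as
  `Literature.Barriers.NavierStokesRegularity.buckmasterVicol_nonuniqueness_of_thm12` (same file).
* The energy conclusion `∫_{T³} ‖v(t,x)‖² dx = e(t)` on `[0,T]` is also available as the
  predicate `HasPrescribedEnergy v e T`; `buckmasterVicol_nonuniqueness_iff_hasPrescribedEnergy`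
  (proved, `Iff.rfl`) is the fact in that spelling. (A former duplicate named fact
  `buckmasterVicol_nonuniqueness'` in that spelling was retired: it carried no content of its
  own.)
* Smoothness of `e` on the closed interval is `ContDiffOn ℝ ∞ e (Icc 0 T)`.
* The nonuniqueness corollary `buckmasterVicol_nonunique_weak_solutions` (two distinct weak
  solutions with the same zero initial datum, in the initial-datum formulation
  `Torus.IsWeakNSSolutionWithDataOn`) is a THEOREM proved here from the Thm. 1.2 fact
  `buckmasterVicol_nonuniqueness` (it was a separate named fact until 2026-08-15; being the
  one-line remark on p. 4 of the source and not an independent result, it is now derived, with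
  the same name and statement): choose a smooth energy profile vanishing on `[0, T/3]` and equal
  to `1` at `t = 2T/3`; since `H^β ⊆ L²` (`Torus.MemSobolev.memLp_two_holds`, proved in
  `TorusSobolevNormProofs`) the slices `v(t)`, `t ≤ T/3`, vanish a.e., and a smooth time cutoff
  turns the weak identity on `(0,T)` into the one with zero initial datum on `[0,T)`
  (Temam, Ch. III §1.1). The helper lemmas of this argument are `private`.

## Mathlib

Mathlib has no Navier–Stokes notions (searched `NavierStokes`, `weak solution`, `Beltrami`:
none); everything fluid-related comes from the H21 Sobolev prelude. `ContDiffOn`, `Set.Icc`,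
the Bochner integral, `Real.smoothTransition` (smooth cutoffs) are Mathlib's.

## References

* T. Buckmaster, V. Vicol, *Nonuniqueness of weak solutions to the Navier–Stokes equation*,
  Ann. of Math. 189 (2019), 101–144, Def. 1.1, Thm. 1.2 (p. 3), the paragraph following
  Thm. 1.2 (p. 4), Thm. 1.3.
* R. Temam, *Navier–Stokes Equations* (3rd ed., 1984), Ch. III §1.1, (1.22)–(1.24) (weak
  formulation with initial datum; time cutoffs).
-/

open MeasureTheory Set
open scoped ContDiff

namespace Literature.Analysis.FluidPDE

noncomputable section

section NS

/-- The velocity field `v : ℝ → T³ → ℝ³` has the prescribed kinetic-energy profile `e` on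
`[0, T]`: `∫_{T³} ‖v(t, x)‖² dx = e(t)` for every `t ∈ [0, T]` (Buckmaster–Vicol 2019,
Thm. 1.2, the conclusion). Junk: the Bochner integral is `0` when `‖v t ·‖²` is not
integrable. [cite: BuckmasterVicol2019AnnMath, Thm. 1.2 (the conclusion)] -/
def HasPrescribedEnergy (v : ℝ → UnitAddTorus (Fin 3) → EuclideanSpace ℝ (Fin 3)) (e : ℝ → ℝ)
    (T : ℝ) : Prop :=
  ∀ t ∈ Icc 0 T, ∫ x, ‖v t x‖ ^ 2 = e t

/-- Unfolding lemma for `HasPrescribedEnergy`. [folklore] -/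
theorem hasPrescribedEnergy_iff (v : ℝ → UnitAddTorus (Fin 3) → EuclideanSpace ℝ (Fin 3))
    (e : ℝ → ℝ) (T : ℝ) :
    HasPrescribedEnergy v e T ↔ ∀ t ∈ Icc 0 T, ∫ x, ‖v t x‖ ^ 2 = e t :=
  Iff.rfl

/-- **ns.S18** (Buckmaster–Vicol, Ann. of Math. 189 (2019), Thm. 1.2; known theorem).
There exists `β > 0` such that for every viscosity `ν > 0`, every `T > 0` and every smooth
nonnegative energy profile `e : [0,T] → ℝ`, there is a weak solution `v` of the unforced
Navier–Stokes equations on `T³ × (0,T)` (BV Def. 1.1: distributional, `L²_{t,x}`, weakly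
divergence free, mean zero) with `v ∈ C⁰([0,T]; H^β(T³))` and `∫_{T³} |v(x,t)|² dx = e(t)`
for all `t ∈ [0,T]`. Buckmaster–Vicol fix a viscosity `ν ∈ (0,1]` (op. cit. p. 3) and `β`
may depend on it (printed form:
`Literature.Barriers.NavierStokesRegularity.BuckmasterVicol2019_thm12`); the present `ν`-general
form with one `β` for all `ν > 0` is the outline's and follows from the printed one at `ν = 1`
by time rescaling (proved:
`Literature.Barriers.NavierStokesRegularity.buckmasterVicol_nonuniqueness_of_thm12`). The
vorticity clause of Thm. 1.2 (`curl v ∈ C⁰_t L¹_x`) is not transcribed. The mean-zero conjunct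
restores BV Def. 1.1, which `Torus.IsWeakNSSolutionOn` omits by design.
[cite: BuckmasterVicol2019AnnMath, Def. 1.1 and Thm. 1.2] -/
def buckmasterVicol_nonuniqueness : Prop :=
  ∃ β : ℝ, 0 < β ∧ ∀ ν : ℝ, 0 < ν → ∀ T : ℝ, 0 < T → ∀ e : ℝ → ℝ,
      ContDiffOn ℝ ∞ e (Icc 0 T) → (∀ t ∈ Icc 0 T, 0 ≤ e t) →
      ∃ v : ℝ → UnitAddTorus (Fin 3) → EuclideanSpace ℝ (Fin 3),
        FunctionSpaces.Torus.IsWeakNSSolutionOn T ν v ∧ (∀ t, FunctionSpaces.Torus.HasZeroMean (v t)) ∧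
        FunctionSpaces.Torus.ContinuousInSobolevOn (Icc 0 T) β (fun t => FunctionSpaces.EuclideanSpace.complexify ∘ v t) ∧
        ∀ t ∈ Icc 0 T, ∫ x, ‖v t x‖ ^ 2 = e t

/-- The named fact `buckmasterVicol_nonuniqueness` (ns.S18; Buckmaster–Vicol 2019, Thm. 1.2 in
the tree's `ν`-general rendering) with its energy conclusion
`∀ t ∈ [0,T], ∫_{T³} ‖v(t,x)‖² dx = e(t)` spelled as `HasPrescribedEnergy v e T`, whose body is
that very formula: the two spellings agree by definition (`Iff.rfl`). This proved reformulation
replaces the former duplicate named fact `buckmasterVicol_nonuniqueness'` (retired; it was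
discharged by, and only by, a proof of `buckmasterVicol_nonuniqueness`). [folklore] -/
theorem buckmasterVicol_nonuniqueness_iff_hasPrescribedEnergy :
    buckmasterVicol_nonuniqueness ↔
      ∃ β : ℝ, 0 < β ∧ ∀ ν : ℝ, 0 < ν → ∀ T : ℝ, 0 < T → ∀ e : ℝ → ℝ,
        ContDiffOn ℝ ∞ e (Icc 0 T) → (∀ t ∈ Icc 0 T, 0 ≤ e t) →
        ∃ v : ℝ → UnitAddTorus (Fin 3) → EuclideanSpace ℝ (Fin 3),
          FunctionSpaces.Torus.IsWeakNSSolutionOn T ν v ∧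
          (∀ t, FunctionSpaces.Torus.HasZeroMean (v t)) ∧
          FunctionSpaces.Torus.ContinuousInSobolevOn (Icc 0 T) β
            (fun t => FunctionSpaces.EuclideanSpace.complexify ∘ v t) ∧
          HasPrescribedEnergy v e T :=
  Iff.rfl

/-! ### Nonuniqueness from a time slice (Buckmaster–Vicol 2019, p. 4), proved from Thm. 1.2 -/

section Corollary

open Filter _root_.Topology
open scoped InnerProductSpace

/-- A smooth step: for `a < b` there is `χ ∈ C^∞(ℝ)`, `χ ≥ 0`, with `χ = 0` on `(-∞, a]` and
`χ = 1` on `[b, ∞)` (Mathlib's `Real.smoothTransition`, rescaled). [folklore] -/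
private theorem exists_smooth_step {a b : ℝ} (hab : a < b) :
    ∃ χ : ℝ → ℝ, ContDiff ℝ ∞ χ ∧ (∀ t, 0 ≤ χ t) ∧ (∀ t ≤ a, χ t = 0) ∧ ∀ t, b ≤ t → χ t = 1 := by
  refine ⟨fun t => Real.smoothTransition ((t - a) / (b - a)), ?_,
    fun t => Real.smoothTransition.nonneg _, fun t ht => ?_, fun t ht => ?_⟩
  · exact Real.smoothTransition.contDiff.comp ((contDiff_id.sub contDiff_const).div_const _)
  · exact Real.smoothTransition.zero_of_nonpos
      (div_nonpos_of_nonpos_of_nonneg (by linarith) (by linarith))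
  · exact Real.smoothTransition.one_of_one_le ((one_le_div (by linarith)).2 (by linarith))

/-- Products `χ(t) ψ(t, x)` of a smooth time cutoff vanishing on `(-∞, a]`, `a > 0`, with a
space–time test field on `[0, T)` are test fields compactly supported in `(0, T)`
(Temam 1984, Ch. III §1.1). [folklore] -/
private theorem isSpaceTimeTestIoo_smul {T a : ℝ} {χ : ℝ → ℝ} (hχ : ContDiff ℝ ∞ χ)
    (ha : 0 < a) (hχ0 : ∀ t ≤ a, χ t = 0)
    {ψ : ℝ → UnitAddTorus (Fin 3) → EuclideanSpace ℝ (Fin 3)}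
    (hψ : FunctionSpaces.Torus.IsSpaceTimeTest T ψ) :
    FunctionSpaces.Torus.IsSpaceTimeTestIoo T (fun t x => χ t • ψ t x) := by
  obtain ⟨hs, T', hT', h0⟩ := hψ
  refine ⟨⟨?_, T', hT', fun t ht => ?_⟩, a, ha, fun t ht => ?_⟩
  · have h : FunctionSpaces.Torus.stLift (fun t x => χ t • ψ t x) =
        fun p : ℝ × EuclideanSpace ℝ (Fin 3) => χ p.1 • FunctionSpaces.Torus.stLift ψ p := by
      funext p
      rfl
    rw [h]
    exact (hχ.comp contDiff_fst).smul hs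
  · funext x
    simp [h0 t ht]
  · funext x
    simp [hχ0 t ht]

/-- Products `χ(t) ψ(t, x)` with a divergence-free test field `ψ` are divergence free
(the divergence is `ℝ`-linear in the field: `∂ᵢ (c ψᵢ) = c ∂ᵢ ψᵢ`, Mathlib
`deriv_const_mul_field`). [folklore] -/
private theorem isDivFreeTest_smul (χ : ℝ → ℝ)
    {ψ : ℝ → UnitAddTorus (Fin 3) → EuclideanSpace ℝ (Fin 3)}
    (hdiv : FunctionSpaces.Torus.IsDivFreeTest ψ) :
    FunctionSpaces.Torus.IsDivFreeTest (fun t x => χ t • ψ t x) := by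
  intro t x
  have h := hdiv t x
  unfold FunctionSpaces.Torus.divergence FunctionSpaces.Torus.partialDeriv
    FunctionSpaces.Torus.lineDeriv at h ⊢
  simp only [PiLp.smul_apply, smul_eq_mul, deriv_const_mul_field]
  rw [← Finset.mul_sum, h, mul_zero]

/-- `H^β ⊆ L²` for complexified real fields: if `complexify ∘ u ∈ H^β(T³; ℂ³)` with `0 ≤ β`,
then `u ∈ L²(T³; ℝ³)` (`Torus.MemSobolev.memLp_two_holds`, and measurability / norms transfer
along the isometric embedding `complexify`). [folklore] -/
private theorem memLp_two_of_memSobolev_complexify {β : ℝ} (hβ : 0 ≤ β)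
    {u : UnitAddTorus (Fin 3) → EuclideanSpace ℝ (Fin 3)}
    (h : FunctionSpaces.Torus.MemSobolev β (FunctionSpaces.EuclideanSpace.complexify ∘ u)) :
    MemLp u 2 volume := by
  have h2 : MemLp (FunctionSpaces.EuclideanSpace.complexify ∘ u) 2 volume :=
    FunctionSpaces.Torus.MemSobolev.memLp_two_holds h hβ
  have hm : AEStronglyMeasurable u volume :=
    (FunctionSpaces.EuclideanSpace.complexify (ι := Fin 3)).isometry.isEmbedding
      |>.aestronglyMeasurable_comp_iff.1 h2.1
  refine h2.of_le hm (ae_of_all _ fun x => ?_)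
  simp only [Function.comp_apply, FunctionSpaces.EuclideanSpace.norm_complexify, le_refl]

/-- An `L²` field with vanishing kinetic energy `∫ ‖u‖² = 0` is zero a.e. [folklore] -/
private theorem ae_eq_zero_of_integral_norm_sq_eq_zero
    {u : UnitAddTorus (Fin 3) → EuclideanSpace ℝ (Fin 3)} (hu : MemLp u 2 volume)
    (h0 : ∫ x, ‖u x‖ ^ 2 = 0) : u =ᵐ[volume] 0 := by
  have hint : Integrable (fun x => ‖u x‖ ^ 2) volume :=
    (memLp_two_iff_integrable_sq_norm hu.1).1 hu
  have hae : (fun x => ‖u x‖ ^ 2) =ᵐ[volume] 0 :=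
    (integral_eq_zero_iff_of_nonneg (fun x => sq_nonneg _) hint).1 h0
  filter_upwards [hae] with x hx
  simpa using hx

/-- **From the open time interval to the initial-datum formulation, for a field at rest
initially.** If `u` is a weak solution on `T³ × (0,T)` (tests supported in `(0,T)`,
`Torus.IsWeakNSSolutionOn`) and `u(t) = 0` a.e. on `T³` for every `t ∈ [0, a]`, `a > 0`, then
`u` is a weak solution on `T³ × [0,T)` with initial datum `0` (tests on `[0,T)`,
`Torus.IsWeakNSSolutionWithDataOn`). Proof: multiply a test field `ψ` by a smooth cutoff
`χ(t)` vanishing for `t ≤ a/2` and equal to `1` for `t ≥ a`; `χψ` is an admissible test on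
`(0,T)`, and the space integrals of the weak integrands of `ψ` and of `χψ` agree at every time
`t ∈ (0,T)` (for `t ≤ a` both vanish since `u(t) = 0` a.e.; for `t > a`, `χ ≡ 1` near `t`);
the datum term `∫⟪0, ψ(0)⟫` vanishes (Temam 1984, Ch. III §1.1, (1.22)–(1.24)). [folklore] -/
private theorem isWeakNSSolutionWithDataOn_zero_of_ae_eq_zero {T ν a : ℝ}
    {u : ℝ → UnitAddTorus (Fin 3) → EuclideanSpace ℝ (Fin 3)}
    (hu : FunctionSpaces.Torus.IsWeakNSSolutionOn T ν u) (ha : 0 < a)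
    (h0 : ∀ t ∈ Icc 0 a, u t =ᵐ[volume] 0) :
    FunctionSpaces.Torus.IsWeakNSSolutionWithDataOn T ν 0 u := by
  obtain ⟨hm, h2, hdf, hweak⟩ := hu
  refine ⟨hm, h2, hdf, fun ψ hψ hdiv => ?_⟩
  obtain ⟨χ, hχ, -, hχ0, hχ1⟩ := exists_smooth_step (half_lt_self ha)
  -- the weak identity on `(0, T)` tested with the cut-off field `χ ψ`
  have hid := hweak (fun t x => χ t • ψ t x)
    (isSpaceTimeTestIoo_smul hχ (half_pos ha) hχ0 hψ) (isDivFreeTest_smul χ hdiv)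
  -- the datum term vanishes
  simp only [Pi.zero_apply, inner_zero_left, integral_zero, add_zero]
  refine Eq.trans (integral_congr_ae ?_) hid
  filter_upwards [ae_restrict_mem measurableSet_Ioo] with t ht
  by_cases hta : t ≤ a
  · -- `u t = 0` a.e.: both space integrals vanish
    have hut : ∀ᵐ x ∂volume, u t x = 0 := h0 t ⟨ht.1.le, hta⟩
    trans (0 : ℝ)
    · exact integral_eq_zero_of_ae (hut.mono fun x hx => by simp [hx])
    · exact (integral_eq_zero_of_ae (hut.mono fun x hx => by simp [hx])).symm
  · -- `χ ≡ 1` near `t`: the integrands coincide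
    replace hta : a < t := not_le.mp hta
    have hχt : ∀ᶠ s in 𝓝 t, χ s = 1 :=
      mem_of_superset (Ioi_mem_nhds hta) fun s hs => hχ1 s (le_of_lt hs)
    have hslice : (fun y => χ t • ψ t y) = ψ t := by
      funext y
      rw [hχ1 t hta.le, one_smul]
    have hderiv : ∀ x, FunctionSpaces.Torus.timeDeriv (fun s y => χ s • ψ s y) t x =
        FunctionSpaces.Torus.timeDeriv ψ t x := by
      intro x
      unfold FunctionSpaces.Torus.timeDeriv
      exact Filter.EventuallyEq.deriv_eq (hχt.mono fun s hs => by simp [hs])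
    simp only [hderiv]
    rw [hslice]

/-- The zero field is a weak solution with zero datum on `T³ × [0,T)` (every integrand
vanishes). [folklore] -/
private theorem isWeakNSSolutionWithDataOn_zero (T ν : ℝ) :
    FunctionSpaces.Torus.IsWeakNSSolutionWithDataOn T ν
      (0 : UnitAddTorus (Fin 3) → EuclideanSpace ℝ (Fin 3))
      (0 : ℝ → UnitAddTorus (Fin 3) → EuclideanSpace ℝ (Fin 3)) := by
  refine ⟨?_, ?_, ?_, ?_⟩
  · exact aestronglyMeasurable_const (b := (0 : EuclideanSpace ℝ (Fin 3)))
  · simp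
  · exact Filter.Eventually.of_forall fun t θ _ => by simp
  · intro ψ _ _
    simp

/-- The zero field lies in `C⁰(S; H^β(T³))` for every time set `S` and every `β`
(`complexify ∘ 0 = 0`, `Torus.memSobolev_zero_fun`, `Torus.eSobolevNorm_zero_fun`). [folklore] -/
private theorem continuousInSobolevOn_zero (S : Set ℝ) (β : ℝ) :
    FunctionSpaces.Torus.ContinuousInSobolevOn S β
      (fun t => FunctionSpaces.EuclideanSpace.complexify ∘
        (0 : ℝ → UnitAddTorus (Fin 3) → EuclideanSpace ℝ (Fin 3)) t) := by
  have h0 : ∀ t : ℝ, FunctionSpaces.EuclideanSpace.complexify ∘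
      (0 : ℝ → UnitAddTorus (Fin 3) → EuclideanSpace ℝ (Fin 3)) t =
        (0 : UnitAddTorus (Fin 3) → EuclideanSpace ℂ (Fin 3)) := by
    intro t
    funext x
    simp
  refine ⟨fun t _ => ?_, fun t₀ _ => ?_⟩
  · beta_reduce
    rw [h0]
    exact FunctionSpaces.Torus.memSobolev_zero_fun β
  · beta_reduce
    simp only [h0, sub_zero, FunctionSpaces.Torus.eSobolevNorm_zero_fun]
    exact tendsto_const_nhds

/-- **Nonuniqueness of weak solutions from a time slice** — corollary of ns.S18
(Buckmaster–Vicol 2019, Thm. 1.2 ⇒ nonuniqueness, the paragraph following Thm. 1.2 on p. 4: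
"In particular, the above theorem shows that `v ≡ 0` is not the only weak solution which
vanishes at a time slice, thereby implying the nonuniqueness of weak solutions"): assuming the
Thm. 1.2 fact `buckmasterVicol_nonuniqueness`, for every `ν > 0` and `T > 0` there are `β > 0`
and two *distinct* mean-zero weak solutions `v w ∈ C⁰([0,T]; H^β(T³))` of Navier–Stokes on
`T³ × [0,T)` with the same (zero) initial datum in the sense of
`Torus.IsWeakNSSolutionWithDataOn`. "Distinct" is stated robustly as `‖v(t) − w(t)‖_{L²} ≠ 0`
for some `t ∈ (0,T)` (plain `v ≠ w` would be satisfiable by changing `v` outside `[0,T]` or on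
a null set).

Proof (the remark on p. 4 made explicit): take `w = 0` and `v` from Thm. 1.2 with a smooth
energy profile `e ≥ 0` on `[0,T]` vanishing on `[0, T/3]` and equal to `1` at `t = 2T/3`
(`Real.smoothTransition`); then `∫ ‖v(2T/3)‖² = 1 ≠ 0`. Every slice `v(t)`, `t ∈ [0,T]`, lies
in `H^β ⊆ L²` (`Torus.MemSobolev.memLp_two_holds`), so for `t ≤ T/3` the genuine identity
`∫ ‖v(t)‖² = e(t) = 0` forces `v(t) = 0` a.e.; a smooth time cutoff then upgrades the weak
identity on `(0,T)` to the one with zero initial datum on `[0,T)`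
(`isWeakNSSolutionWithDataOn_zero_of_ae_eq_zero`). This declaration was a separate named fact
until 2026-08-15; it is now a theorem conditional only on the Thm. 1.2 fact.
[cite: BuckmasterVicol2019AnnMath, Thm. 1.2 and the paragraph following it (p. 4, nonuniqueness from a time slice)] -/
theorem buckmasterVicol_nonunique_weak_solutions (h : buckmasterVicol_nonuniqueness) :
    ∀ (ν : ℝ) (hν : 0 < ν) (T : ℝ) (hT : 0 < T),
    ∃ β : ℝ, 0 < β ∧ ∃ v w : ℝ → UnitAddTorus (Fin 3) → EuclideanSpace ℝ (Fin 3),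
      (∃ t ∈ Ioo 0 T, ∫ x, ‖v t x - w t x‖ ^ 2 ≠ 0) ∧
      FunctionSpaces.Torus.IsWeakNSSolutionWithDataOn T ν 0 v ∧ FunctionSpaces.Torus.IsWeakNSSolutionWithDataOn T ν 0 w ∧
      (∀ t, FunctionSpaces.Torus.HasZeroMean (v t)) ∧ (∀ t, FunctionSpaces.Torus.HasZeroMean (w t)) ∧
      FunctionSpaces.Torus.ContinuousInSobolevOn (Icc 0 T) β (fun t => FunctionSpaces.EuclideanSpace.complexify ∘ v t) ∧
      FunctionSpaces.Torus.ContinuousInSobolevOn (Icc 0 T) β (fun t => FunctionSpaces.EuclideanSpace.complexify ∘ w t) := by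
  intro ν hν T hT
  obtain ⟨β, hβ, hall⟩ := h
  -- the energy profile: a smooth step from `0` on `[0, T/3]` to `1` on `[2T/3, ∞)`
  obtain ⟨e, he, he0, hezero, heone⟩ := exists_smooth_step (show T / 3 < 2 * T / 3 by linarith)
  obtain ⟨v, hweak, hmean, hcont, henergy⟩ :=
    hall ν hν T hT e he.contDiffOn (fun t _ => he0 t)
  refine ⟨β, hβ, v, 0, ⟨2 * T / 3, ⟨by linarith, by linarith⟩, ?_⟩, ?_,
    isWeakNSSolutionWithDataOn_zero T ν, hmean,
    fun t => by simp [FunctionSpaces.Torus.HasZeroMean], hcont, continuousInSobolevOn_zero _ β⟩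
  · -- the two solutions differ at `t = 2T/3`, where `∫ ‖v‖² = 1`
    have h1 := henergy (2 * T / 3) ⟨by linarith, by linarith⟩
    rw [heone _ le_rfl] at h1
    simp only [Pi.zero_apply, sub_zero]
    rw [h1]
    exact one_ne_zero
  · -- zero initial datum in the weak sense: `v(t) = 0` a.e. for `t ∈ [0, T/3]`
    refine isWeakNSSolutionWithDataOn_zero_of_ae_eq_zero hweak (by linarith : 0 < T / 3)
      fun t ht => ?_
    have htT : t ∈ Icc 0 T := ⟨ht.1, ht.2.trans (by linarith)⟩
    have hL2 : MemLp (v t) 2 volume :=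
      memLp_two_of_memSobolev_complexify hβ.le (hcont.1 t htT)
    refine ae_eq_zero_of_integral_norm_sq_eq_zero hL2 ?_
    rw [henergy t htT, hezero t ht.2]

end Corollary

end NS

end

end Literature.Analysis.FluidPDE
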